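import Summits.NavierStokesRegularity.NavierStokesRegularity.Theses.AxisymmetricExtremality
import Summits.NavierStokesRegularity.NavierStokesRegularity.Theorems.AxisymmetricExtremalityAxisymmetricKatoGlobalStubKatoAxisymSingularPoint
import Summits.NavierStokesRegularity.NavierStokesRegularity.Theorems.AxisymmetricExtremalityAxisymmetricKatoGlobalStubKatoLocalEnergyNearTop
import Summits.NavierStokesRegularity.NavierStokesRegularity.Theorems.AxisymmetricExtremalityAxisymmetricKatoGlobalStubOffAxisBoundedOfLocalEnergy
import Summits.NavierStokesRegularity.NavierStokesRegularity.Theorems.AxisymmetricExtremalityAxisymmetricKatoGlobalStubAxisBoundedOfLocalEnergyOrigin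
import Literature.Analysis.FluidPDE.Seregin2022LogSwirlCriterion
import HarnessLib

/-!
# Reduction of the crux `AxisymmetricExtremality.AxisymmetricKatoGlobal` (stmt-NavierStokesRegularity-15453) to Seregin's local log-swirl criterion and ONE a-priori estimate — line `registered`

Capstone of the line `registered` (lead c1).  Every bookkeeping stub of the registered skeleton
`Cruxes/AxisymmetricKatoGlobal/Lines/registered.lean` has landed in this directory
(`…StubKatoAxisymSingularPoint`, `…StubKatoLocalEnergyNearTop`, `…StubOffAxisBoundedOfLocalEnergy`,
`…StubAxisBoundedOfLocalEnergyOrigin`), so the composition `AxisymmetricKatoGlobal_of` of the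
skeleton becomes the UNCONDITIONAL implication

  `seregin2022_logSwirl_regularAtOrigin → SwirlAxisModulus → AxisymmetricKatoGlobal`

recorded here (`AxisymmetricKatoGlobal_of_logSwirlFacts`), where

* `Literature.Analysis.FluidPDE.seregin2022_logSwirl_regularAtOrigin` is the tree's named fact
  for G. Seregin, J. Math. Fluid Mech. 24 (2022), §2 (local regularity of the origin for
  axisymmetric suitable weak solutions on the unit cylinder under the swirl bound
  `|Γ| ≤ C₁/ln³(e/r)`; a PUBLISHED theorem, undischarged in the tree), and
* the second hypothesis is verbatim the registered stub `stub_swirlAxisModulus`: the logarithmic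
  modulus of continuity of the swirl `Γ = r u_θ` at the axis, uniformly up to the final time of an
  axisymmetric Kato solution — trivial strictly below the lifespan (`swirlAxisModulus_of_lt`,
  `…SwirlAxisModulusBelow.lean`) and, at `T = T_max`, the OPEN a-priori estimate carrying the whole
  difficulty of axisymmetric-with-swirl regularity.

So after this file the crux is, machine-checked, "Seregin 2022 §2 + the a-priori axis modulus".
The proof is the skeleton's: no global Kato solution ⇒ maximal Kato solution, smooth and
axisymmetric on `(0,T) × ℝ³`, singular at `(T, x_*)` (stub 1); an axisymmetric pressure making it
suitable on the open strip with local energy classes reaching `T` (stub K); the modulus on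
`[T/2, T)` (hypothesis); boundedness near `(T, x)` for every `x` — off the axis by rotation
packing + Seregin's ε-regularity (stub 2b'), on the axis by rescaling into Seregin's unit cylinder
(stub 2c' + the named fact); contradiction with the singular cylinder.
-/

noncomputable section

-- the summit and its single problem share the name (D-0017 nested layout)
set_option linter.dupNamespace false

open Set MeasureTheory Filter Topology Function Metric
open scoped ENNReal NNReal
open Literature.Analysis.FluidPDE Literature.Analysis.FunctionSpaces

namespace Summit.NavierStokesRegularity.NavierStokesRegularity.Theorems.AxisymmetricKatoGlobal.Registered

/-- A pointwise bound on the backward cylinder `(T − r², T) × B_r(x_*)` makes the `L^∞` norm of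
`uncurry u` on `parabolicCylinder r (T, x_*)` finite. -/
theorem eLpNorm_parabolicCylinder_lt_top_of_forall_le
    {u : ℝ → EuclideanSpace ℝ (Fin 3) → EuclideanSpace ℝ (Fin 3)} {T r K : ℝ}
    {xs : EuclideanSpace ℝ (Fin 3)}
    (h : ∀ t ∈ Ioo (T - r ^ 2) T, ∀ x ∈ ball xs r, ‖u t x‖ ≤ K) :
    eLpNorm (uncurry u) ∞
      (volume.restrict (parabolicCylinder r ((T, xs) : ℝ × EuclideanSpace ℝ (Fin 3)))) < ∞ := by
  have hmeas : MeasurableSet (parabolicCylinder r ((T, xs) : ℝ × EuclideanSpace ℝ (Fin 3))) := by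
    unfold parabolicCylinder
    exact measurableSet_Ioo.prod measurableSet_ball
  have hbound : ∀ᵐ z ∂(volume.restrict (parabolicCylinder r ((T, xs) : ℝ × EuclideanSpace ℝ (Fin 3)))),
      ‖uncurry u z‖ ≤ K := by
    filter_upwards [ae_restrict_mem hmeas] with z hz
    obtain ⟨ht, hx⟩ := mem_prod.1 hz
    exact h z.1 ht z.2 hx
  rw [eLpNorm_exponent_top]
  exact (eLpNormEssSup_le_of_ae_bound hbound).trans_lt ENNReal.ofReal_lt_top

/-- **The regularity criterion in the Kato class, conditional on Seregin's local criterion.**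
If `seregin2022_logSwirl_regularAtOrigin` holds, then an axisymmetric Kato solution on `[0, T)`,
smooth on `(0,T) × ℝ³`, whose swirl obeys `|Γ(t,x)| ≤ C / |log (cylRadius x)|³` for
`cylRadius x ≤ δ₀ < 1` uniformly in `t ∈ [t₀, T)`, is bounded near `(T, x₀)` for EVERY `x₀`
(pressure and local energy classes from `stub_katoLocalEnergyNearTop`; off the axis
`stub_offAxisBounded_of_localEnergy`, on the axis `stub_axisBounded_of_localEnergy_origin`). -/
theorem logSwirlRegularity_of_seregin2022 (h2a : seregin2022_logSwirl_regularAtOrigin)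
    {ν T : ℝ} (hν : 0 < ν) (hT : 0 < T)
    {u₀ : EuclideanSpace ℝ (Fin 3) → EuclideanSpace ℝ (Fin 3)}
    {u : ℝ → EuclideanSpace ℝ (Fin 3) → EuclideanSpace ℝ (Fin 3)}
    (hK : IsKatoSolutionOn T ν u₀ u) (hsm : ContDiffOn ℝ (⊤ : ℕ∞) (uncurry u) (Ioo 0 T ×ˢ univ))
    (hax : ∀ t ∈ Ioo 0 T, IsAxisymmetric (u t))
    (hmod : ∃ t₀ ∈ Ioo 0 T, ∃ C δ₀ : ℝ, 0 < δ₀ ∧ δ₀ < 1 ∧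
      ∀ t ∈ Ico t₀ T, ∀ x : EuclideanSpace ℝ (Fin 3), cylRadius x ≤ δ₀ →
        |swirl (u t) x| ≤ C / |Real.log (cylRadius x)| ^ 3)
    (x₀ : EuclideanSpace ℝ (Fin 3)) : IsBoundedNearTop u T x₀ := by
  obtain ⟨p, hpax, hsw, hloc⟩ := stub_katoLocalEnergyNearTop ν hν T hT u₀ u hK hsm hax
  by_cases h0 : cylRadius x₀ = 0
  · exact stub_axisBounded_of_localEnergy_origin h2a ν hν T hT u p hsm hax hpax hsw hloc hmod x₀ h0
  · exact stub_offAxisBounded_of_localEnergy ν hν T hT u p hsm hax hsw hloc x₀ h0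

/-- **The crux `AxisymmetricKatoGlobal` from Seregin's 2022 local log-swirl criterion and the
a-priori axis modulus of the swirl** (the registered skeleton's composition with every landed
stub inlined; the two hypotheses are the named fact `seregin2022_logSwirl_regularAtOrigin` and,
verbatim, the registered stub `stub_swirlAxisModulus`).  By contradiction: singular point of the
maximal Kato solution (`stub_katoAxisymSingularPoint`), modulus on `[T/2, T)`, boundedness near the
singular point (`logSwirlRegularity_of_seregin2022`), finiteness of the `L^∞` norm on a backward
cylinder. -/
theorem AxisymmetricKatoGlobal_of_logSwirlFacts : seregin2022_logSwirl_regularAtOrigin → (∀ ν : ℝ, 0 < ν → ∀ T : ℝ, 0 < T → ∀ (u₀ : EuclideanSpace ℝ (Fin 3) → EuclideanSpace ℝ (Fin 3)) (g : HomSobolev (EuclideanSpace ℝ (Fin 3)) (EuclideanSpace ℂ (Fin 3)) (1 / 2 : ℝ)) (u : ℝ → EuclideanSpace ℝ (Fin 3) → EuclideanSpace ℝ (Fin 3)), g.Represents (Literature.Analysis.FunctionSpaces.EuclideanSpace.complexify ∘ u₀) → IsKatoSolutionOn T ν u₀ u → ContDiffOn ℝ (⊤ : ℕ∞) (uncurry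 u) (Ioo 0 T ×ˢ univ) → (∀ t ∈ Ioo 0 T, IsAxisymmetric (u t)) → ∀ t₀ ∈ Ioo 0 T, ∃ C δ₀ : ℝ, 0 < δ₀ ∧ δ₀ < 1 ∧ ∀ t ∈ Ico t₀ T, ∀ x : EuclideanSpace ℝ (Fin 3), cylRadius x ≤ δ₀ → |swirl (u t) x| ≤ C / |Real.log (cylRadius x)| ^ 3) → Theses.AxisymmetricExtremality.AxisymmetricKatoGlobal := by
  intro h2a h3 ν hν u₀ g hL3 hrep hdiv hax
  -- the written-out rotation-equivariance of the crux is `IsAxisymmetric u₀` definitionally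
  have hax' : IsAxisymmetric u₀ := fun θ x => hax θ x
  by_contra hng
  -- stub 1: a finite-time Kato solution, smooth and axisymmetric inside, singular at `(T, xs)`
  obtain ⟨T, hT, xs, u, hK, hsm, haxi, hsing⟩ :=
    stub_katoAxisymSingularPoint ν hν u₀ hL3 hdiv hax' hng
  -- the logarithmic modulus of the swirl at the axis on `[T/2, T)` (hypothesis)
  have ht₀ : T / 2 ∈ Ioo 0 T := ⟨by linarith, by linarith⟩
  obtain ⟨C, δ₀, hδ₀, hδ₁, hmod⟩ := h3 ν hν T hT u₀ g u hrep hK hsm haxi (T / 2) ht₀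
  -- hence every point, in particular `xs`, is bounded near the final time
  obtain ⟨r, hr, K, hbd⟩ := logSwirlRegularity_of_seregin2022 h2a hν hT hK hsm haxi
    ⟨T / 2, ht₀, C, δ₀, hδ₀, hδ₁, hmod⟩ xs
  -- contradiction with the singularity of `(T, xs)` at radius `r`
  exact absurd (hsing r hr) (eLpNorm_parabolicCylinder_lt_top_of_forall_le hbd).ne

end Summit.NavierStokesRegularity.NavierStokesRegularity.Theorems.AxisymmetricKatoGlobal.Registered

end
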